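import Summits.BirchSwinnertonDyer.Rank1Residual.X11b.ProcyclicDescentRescaled
import Summits.BirchSwinnertonDyer.Rank1Residual.X11b.ProcyclicDescentKernel
import Summits.BirchSwinnertonDyer.BirchSwinnertonDyer.Theorems.UniversalToricDescentInvariantTorsionBound
import HarnessLib

/-!
# Procyclic descent at the LAYERS of a local `ℤ_p`-tower: `H¹(G_n, A) → H¹(H, A)^{G_n}` onto with kernel `≤ #A^H`,
# and the two-sided count of `H¹(H, A)[p^k]^{δ₁^{p^n}}` against `H¹(G_n, A)[p^k]`
# (crux ♭T≤ stmt-BirchSwinnertonDyer-23042, line `sigmacongruence`, stub TS1′ `stub_twinStrictSurj`, brick (1c±)(a)(b))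

Route `UniversalToricDescent`, lead prover `bsd-wall-utd-p1` g17. THEOREMS ONLY (no definition, no named fact, no `sorry`);
`--supports stmt-BirchSwinnertonDyer-23042`. BSD is not proved by any of this.

Setting (generic): a profinite group `G`, a continuous `κ₀ : G → ℤ_p` with EXACT INDEX `c` (`κ₀(G) = p^c ℤ_p`, witnessed by
`δ₁ ∈ G` with `κ₀ δ₁ = p^c` and the divisibility `p^c ∣ κ₀ g`), `H = ker κ₀`, the LAYER subgroups `G_n = κ₀⁻¹(p^{c+n} ℤ_p)`
(given as a subgroup `Gn` with its characterisation `hGn`, no definition), and a discrete `p`-primary `G`-module `A` with open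
stabilisers. On the route: `G = D_𝔭′ ≤ Γ_K` at the strict place, `κ₀ = κ|_{D_𝔭′}` (`kappaD`), `H = kerD κ 𝔭′`, `A = E′[3^∞]`.

* §1 `normal_of_layer`, `pow_mem_layer` — `G_n ⊴ G`, `δ₁^{p^n} ∈ G_n`; `conjH1_pow_eq_self_iff_forall_layer` — **a class of
  `H¹(H, A)` is fixed by `conj_{δ₁^{p^n}}` iff it is fixed by `conj_g` for every `g ∈ G_n`** (approximation `g = (δ₁^{p^n})^m g′`
  with `κ₀ g′` highly divisible + the uniform stabiliser hypothesis (A2)).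
* §2 `exists_transport` — the tautological isomorphism `H¹(ker κ₀, A) ≃ H¹(ker (κ₀|_{G_n}), A)` commuting with conjugation and
  restriction (pure `resH1Hom` functoriality, stated as an existence).
* §3 `exists_resOfLe_eq_of_forall_layer` — **`res : H¹(G_n, A) → H¹(H, A)^{G_n}` is ONTO** (the tree's engine
  `ProcyclicDescent.exists_resSubgroup_eq_of_forall_conjH1_eq` on the profinite group `G_n`);
  `natCard_ker_resOfLe_le` — **`#ker res ≤ #A^H`** (the tree's `natCard_ker_resSubgroup_eq` for the rescaled `κ₀|_{G_n}`).
* §4 `natCard_comap_eq_mul`, `le_and_le_of_res` — generic counting along `res`;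
  `twoSided_count_layer` — **`#H¹(G_n, A)[p^k] ≤ #A^H · #S(n,k)` and `#S(n,k) ≤ #H¹(G_n, A)[p^k]`** for
  `S(n,k) = {y ∈ H¹(H, A) | p^k y = 0, conj_{δ₁^{p^n}} y = y}`, with `S(n,k)` finite when `H¹(G_n, A)[p^k]` and `A^H` are.

References: [GreenbergLNM1716] §3 Lemma 3.3 (p. 87: inflation–restriction over a procyclic quotient); [SerreGaloisCohomology1997]
I §2.6 (b), XIII §1; [Washington1997] §13.1; [GreenbergVatsal2000] §2 Prop. (2.1) (local terms at `p`).
-/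

set_option autoImplicit false
-- the Theorems namespace of this sub repeats the summit name by design (D-0017 nested layout)
set_option linter.dupNamespace false

noncomputable section

open scoped Classical
open Function
open Literature.NumberTheory.EllipticCurves
  Summit.BirchSwinnertonDyer.Rank1Residual.X11b Summit.BirchSwinnertonDyer.Rank1Residual.X11b.ProcyclicDescent

universe u

namespace Summit.BirchSwinnertonDyer.BirchSwinnertonDyer.Theorems.UniversalToricDescentTowerDescent

section Generic

variable {G : Type u} [Group G] [TopologicalSpace G] [IsTopologicalGroup G]
variable {A : Type u} [AddCommGroup A] [DistribMulAction G A] [TopologicalSpace A] [DiscreteTopology A]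
variable {p : ℕ} [Fact p.Prime] (κ₀ : G →ₜ* Multiplicative ℤ_[p])
variable {c : ℕ} {δ₁ : G} (hδ₁ : (κ₀ δ₁).toAdd = (p : ℤ_[p]) ^ c)
variable {Gn : Subgroup G} {n : ℕ} (hGn : ∀ g : G, g ∈ Gn ↔ (p : ℤ_[p]) ^ (c + n) ∣ (κ₀ g).toAdd)

/-! ### §1 The layer subgroups -/

omit [IsTopologicalGroup G] in
include hGn in
/-- `ker κ₀ ≤ G_n`. [folklore] -/
theorem kerK_le_layer : kerK κ₀ ≤ Gn := fun g hg ↦ by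
  rw [hGn, show κ₀ g = 1 from hg, toAdd_one]
  exact dvd_zero _

omit [IsTopologicalGroup G] in
include hGn in
/-- `G_n ⊴ G` (`κ₀` has abelian target). [folklore] -/
theorem normal_layer : Gn.Normal := by
  refine ⟨fun g hg h ↦ ?_⟩
  rw [hGn] at hg ⊢
  rwa [map_mul κ₀, map_mul κ₀, map_inv κ₀, toAdd_mul, toAdd_mul, toAdd_inv, add_neg_cancel_comm]

omit [IsTopologicalGroup G] in
include hδ₁ hGn in
/-- `δ₁^{p^n m} ∈ G_n`. [folklore] -/
theorem pow_pow_mul_mem_layer (m : ℕ) : δ₁ ^ (p ^ n * m) ∈ Gn := by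
  rw [hGn, map_pow κ₀, ← ofAdd_toAdd (κ₀ δ₁), ← ofAdd_nsmul, toAdd_ofAdd, hδ₁, nsmul_eq_mul, Nat.cast_mul, Nat.cast_pow,
    pow_add]
  exact ⟨(m : ℤ_[p]), by ring⟩

omit [IsTopologicalGroup G] in
include hGn in
/-- Continuity of `κ₀` on `G_n`: `p^{c+n} ∣ κ₀ g` for `g ∈ G_n` (restated on the subtype). [folklore] -/
theorem dvd_of_mem_layer (g : Gn) : (p : ℤ_[p]) ^ (c + n) ∣ (κ₀ (g : G)).toAdd := (hGn g).mp g.2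

/-- Fixed by `conj_x` ⟹ fixed by `conj_{x^m}`. [folklore] -/
theorem conjH1_pow_eq_self_of_eq {H : Subgroup G} [H.Normal] {x : G} {y : subgroupH1 H A}
    (hy : conjH1 H A x y = y) (m : ℕ) : conjH1 H A (x ^ m) y = y := by
  induction m with
  | zero => rw [pow_zero, conjH1_one_holds H A, AddMonoidHom.id_apply]
  | succ m ih => rw [pow_succ, conjH1_mul_holds H A, AddMonoidHom.comp_apply, hy, ih]

include hδ₁ hGn in
/-- **A class of `H¹(H, A)` is fixed by `conj_{δ₁^{p^n}}` iff it is fixed by `conj_g` for every `g ∈ G_n`**, granted the uniform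
stabiliser property (A2) «`∃ t, p^t ∣ κ₀ g ⟹ conj_g y = y`»: write `g = (δ₁^{p^n})^m · g′` with `κ₀ g′ ∈ p^{c+n+t} ℤ_p`
(`PadicInt.appr`). [cite: Washington1997, §13.1] [cite: GreenbergLNM1716, §1 (after Conj. 1.3)] -/
theorem conjH1_pow_eq_self_iff_forall_layer (y : subgroupH1 (kerK κ₀) A)
    (hfix : ∃ t : ℕ, ∀ g : G, (p : ℤ_[p]) ^ t ∣ (κ₀ g).toAdd → conjH1 (kerK κ₀) A g y = y) :
    conjH1 (kerK κ₀) A (δ₁ ^ p ^ n) y = y ↔ ∀ g : G, g ∈ Gn → conjH1 (kerK κ₀) A g y = y := by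
  refine ⟨fun hy g hg ↦ ?_, fun h ↦ h _ (by simpa only [mul_one] using pow_pow_mul_mem_layer κ₀ hδ₁ hGn 1)⟩
  obtain ⟨t, ht⟩ := hfix
  obtain ⟨z, hz⟩ := (hGn g).mp hg
  -- `z ≡ m (mod p^t)`
  obtain ⟨w, hw⟩ := Ideal.mem_span_singleton.mp (PadicInt.appr_spec t z)
  set m : ℕ := z.appr t with hm
  -- `g = (δ₁^{p^n})^m · g'`
  set g' : G := ((δ₁ ^ p ^ n) ^ m)⁻¹ * g with hg'
  have hκg' : (κ₀ g').toAdd = (p : ℤ_[p]) ^ (c + n) * ((p : ℤ_[p]) ^ t * w) := by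
    rw [hg', map_mul κ₀, map_inv κ₀, toAdd_mul, toAdd_inv, ← pow_mul, map_pow κ₀, ← ofAdd_toAdd (κ₀ δ₁), ← ofAdd_nsmul,
      toAdd_ofAdd, hδ₁, hz, nsmul_eq_mul, Nat.cast_mul, Nat.cast_pow, pow_add]
    linear_combination (p : ℤ_[p]) ^ c * (p : ℤ_[p]) ^ n * hw
  have hfix' : conjH1 (kerK κ₀) A g' y = y := ht g' ⟨(p : ℤ_[p]) ^ (c + n) * w, by rw [hκg']; ring⟩
  have e : g = (δ₁ ^ p ^ n) ^ m * g' := by rw [hg', mul_inv_cancel_left]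
  rw [e, conjH1_mul_holds (kerK κ₀) A, AddMonoidHom.comp_apply, hfix', conjH1_pow_eq_self_of_eq hy m]

/-! ### §2 The tautological transport `H¹(ker κ₀, A) ≃ H¹(ker(κ₀|_{G_n}), A)` -/

/-- **Transport along `ker κ₀ = ker(κ₀|_{G_n})`** (the same elements of `G`, once as a subgroup of `G`, once of `G_n`): an
additive isomorphism of the `H¹`'s commuting with conjugation by `G_n` and turning `res_{G_n → ker κ₀}` into the restriction
of the profinite group `G_n` to its subgroup `ker(κ₀|_{G_n})` (pure `resH1Hom` functoriality). [cite: SerreGaloisCohomology1997, I §2.4] -/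
theorem exists_transport (hH : kerK κ₀ ≤ Gn) :
    ∃ τ : subgroupH1 (kerK κ₀) A ≃+ subgroupH1 (kerK (κ₀.comp (subgroupIncl Gn))) A,
      (∀ (g : Gn) (y : subgroupH1 (kerK κ₀) A),
          τ (conjH1 (kerK κ₀) A (g : G) y) = conjH1 (kerK (κ₀.comp (subgroupIncl Gn))) A g (τ y)) ∧
      (∀ z : subgroupH1 Gn A,
          τ (resOfLe A hH z) = ResKernel.resSubgroup (kerK (κ₀.comp (subgroupIncl Gn))) A z) := by
  -- the two tautological continuous isomorphisms between `ker(κ₀|_{G_n}) ≤ G_n` and `ker κ₀ ≤ G`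
  let θ : (kerK (κ₀.comp (subgroupIncl Gn)) : Subgroup Gn) →ₜ* (kerK κ₀ : Subgroup G) :=
    { toFun := fun x ↦ ⟨((x : Gn) : G), by exact x.2⟩
      map_one' := rfl
      map_mul' := fun _ _ ↦ rfl
      continuous_toFun := (continuous_subtype_val.comp continuous_subtype_val).subtype_mk fun x ↦ by exact x.2 }
  let θ' : (kerK κ₀ : Subgroup G) →ₜ* (kerK (κ₀.comp (subgroupIncl Gn)) : Subgroup Gn) :=
    { toFun := fun x ↦ ⟨⟨(x : G), hH x.2⟩, by exact x.2⟩
      map_one' := rfl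
      map_mul' := fun _ _ ↦ rfl
      continuous_toFun :=
        (continuous_subtype_val.subtype_mk fun x : (kerK κ₀ : Subgroup G) ↦ hH x.2).subtype_mk fun x ↦ by exact x.2 }
  have hθθ' : θ.comp θ' = ContinuousMonoidHom.id _ := ContinuousMonoidHom.ext fun _ ↦ rfl
  have hθ'θ : θ'.comp θ = ContinuousMonoidHom.id _ := ContinuousMonoidHom.ext fun _ ↦ rfl
  let τ : subgroupH1 (kerK κ₀) A →+ subgroupH1 (kerK (κ₀.comp (subgroupIncl Gn))) A :=
    resH1Hom θ (AddMonoidHom.id A) fun _ _ ↦ rfl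
  let τ' : subgroupH1 (kerK (κ₀.comp (subgroupIncl Gn))) A →+ subgroupH1 (kerK κ₀) A :=
    resH1Hom θ' (AddMonoidHom.id A) fun _ _ ↦ rfl
  have h1 : τ'.comp τ = AddMonoidHom.id _ := by
    rw [resH1Hom_comp, resH1Hom_congr hθθ' (AddMonoidHom.comp_id (AddMonoidHom.id A)) (fun _ _ ↦ rfl) (fun _ _ ↦ rfl),
      resH1Hom_id]
  have h2 : τ.comp τ' = AddMonoidHom.id _ := by
    rw [resH1Hom_comp, resH1Hom_congr hθ'θ (AddMonoidHom.comp_id (AddMonoidHom.id A)) (fun _ _ ↦ rfl) (fun _ _ ↦ rfl),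
      resH1Hom_id]
  let e : subgroupH1 (kerK κ₀) A ≃+ subgroupH1 (kerK (κ₀.comp (subgroupIncl Gn))) A :=
    { toFun := τ
      invFun := τ'
      left_inv := fun y ↦ DFunLike.congr_fun h1 y
      right_inv := fun x ↦ DFunLike.congr_fun h2 x
      map_add' := fun y y' ↦ map_add τ y y' }
  refine ⟨e, fun g y ↦ ?_, fun z ↦ ?_⟩
  · -- conjugation
    have key : τ.comp (conjH1 (kerK κ₀) A (g : G)) = (conjH1 (kerK (κ₀.comp (subgroupIncl Gn))) A g).comp τ := by
      rw [conjH1, conjH1, resH1Hom_comp, resH1Hom_comp]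
      congr 1
    exact DFunLike.congr_fun key y
  · -- restriction
    have key : τ.comp (resOfLe A hH) = ResKernel.resSubgroup (kerK (κ₀.comp (subgroupIncl Gn))) A := by
      rw [resOfLe, ResKernel.resSubgroup, resH1Hom_comp]
      congr 1
    exact DFunLike.congr_fun key z

/-! ### §3 Procyclic descent at the layer: surjectivity and the kernel bound -/

include hδ₁ in
omit [IsTopologicalGroup G] in
/-- `κ₀(δ₁^{p^n}) = p^{c+n}`. [folklore] -/
theorem toAdd_apply_pow : (κ₀ (δ₁ ^ p ^ n)).toAdd = (p : ℤ_[p]) ^ (c + n) := by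
  rw [map_pow κ₀, ← ofAdd_toAdd (κ₀ δ₁), ← ofAdd_nsmul, toAdd_ofAdd, hδ₁, nsmul_eq_mul, Nat.cast_pow, ← pow_add, add_comm]

/-- **`res : H¹(G_n, A) → H¹(H, A)^{G_n}` is ONTO** (`H = ker κ₀ ≤ G_n` closed in the profinite `G`, `A` discrete
`p`-primary with open stabilisers): the tree's engine `ProcyclicDescent.exists_resSubgroup_eq_of_forall_conjH1_eq` on the
profinite group `G_n` with the character `κ₀|_{G_n}`, read through the transport of §2.
[cite: SerreGaloisCohomology1997, I §2.6 (b)] [cite: GreenbergLNM1716, §3 Lemma 3.3] -/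
theorem exists_resOfLe_eq_of_forall [CompactSpace G] [T2Space G] [TotallyDisconnectedSpace G]
    (hA : ∀ a : A, IsOpen {g : G | g • a = a}) (hAt : Literature.NumberTheory.GaloisRepresentations.IsPrimaryTorsion p A)
    (hGc : IsClosed (Gn : Set G)) (hH : kerK κ₀ ≤ Gn)
    (y : subgroupH1 (kerK κ₀) A) (hy : ∀ g : G, g ∈ Gn → conjH1 (kerK κ₀) A g y = y) :
    ∃ z : subgroupH1 Gn A, resOfLe A hH z = y := by
  haveI : CompactSpace Gn := isCompact_iff_compactSpace.mp hGc.isCompact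
  have hAn : ∀ a : A, IsOpen {g : Gn | g • a = a} := fun a ↦ (hA a).preimage continuous_subtype_val
  obtain ⟨τ, hτc, hτr⟩ := exists_transport (A := A) κ₀ hH
  obtain ⟨z, hz⟩ := ProcyclicDescent.exists_resSubgroup_eq_of_forall_conjH1_eq hAn (κ₀.comp (subgroupIncl Gn)) hAt (τ y)
    (fun g ↦ by rw [← hτc, hy g g.2])
  refine ⟨z, τ.injective ?_⟩
  rw [hτr, hz]

include hδ₁ hGn in
/-- **`#ker(res : H¹(G_n, A) → H¹(H, A)) ≤ #A^H`** (`H = ker κ₀`): the kernel is `A^H/(γ_n⁻¹ − 1)A^H` for the rescaled character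
`p^{-(c+n)} κ₀|_{G_n} : G_n ↠ ℤ_p` and `γ_n = δ₁^{p^n}` (the tree's `natCard_ker_resSubgroup_eq`), a quotient of the finite `A^H`.
[cite: GreenbergLNM1716, §3 proof of Lemma 3.3 (p. 87)] [cite: SerreGaloisCohomology1997, XIII §1] -/
theorem natCard_ker_resOfLe_le [CompactSpace G] [T2Space G] [TotallyDisconnectedSpace G]
    (hA : ∀ a : A, IsOpen {g : G | g • a = a}) (hAt : Literature.NumberTheory.GaloisRepresentations.IsPrimaryTorsion p A)
    (hGc : IsClosed (Gn : Set G)) [Finite {a : A // ∀ g : G, κ₀ g = 1 → g • a = a}] :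
    Finite (resOfLe A (kerK_le_layer κ₀ hGn)).ker ∧
      Nat.card (resOfLe A (kerK_le_layer κ₀ hGn)).ker ≤ Nat.card {a : A // ∀ g : G, κ₀ g = 1 → g • a = a} := by
  haveI : CompactSpace Gn := isCompact_iff_compactSpace.mp hGc.isCompact
  have hH : kerK κ₀ ≤ Gn := kerK_le_layer κ₀ hGn
  have hAn : ∀ a : A, IsOpen {g : Gn | g • a = a} := fun a ↦ (hA a).preimage continuous_subtype_val
  -- the rescaled character of `G_n`
  have hdiv : ∀ g : Gn, (p : ℤ_[p]) ^ (c + n) ∣ (κ₀.comp (subgroupIncl Gn) g).toAdd := fun g ↦ dvd_of_mem_layer κ₀ hGn g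
  let γn : Gn := ⟨δ₁ ^ p ^ n, by simpa only [mul_one] using pow_pow_mul_mem_layer κ₀ hδ₁ hGn 1⟩
  have hγn : (κ₀.comp (subgroupIncl Gn) γn).toAdd = (p : ℤ_[p]) ^ (c + n) := toAdd_apply_pow (n := n) κ₀ hδ₁
  have hsurj := ProcyclicDescent.rescale_surjective (κ₀.comp (subgroupIncl Gn)) (c + n) hdiv γn hγn
  have hone := ProcyclicDescent.rescale_eq_one (κ₀.comp (subgroupIncl Gn)) (c + n) hdiv γn hγn
  have hker : kerK (ProcyclicDescent.rescale (κ₀.comp (subgroupIncl Gn)) (c + n) hdiv) = kerK (κ₀.comp (subgroupIncl Gn)) :=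
    ProcyclicDescent.kerK_rescale (κ₀.comp (subgroupIncl Gn)) (c + n) hdiv
  have hcount := ProcyclicDescent.natCard_ker_resSubgroup_eq hAn
    (ProcyclicDescent.rescale (κ₀.comp (subgroupIncl Gn)) (c + n) hdiv) hsurj hone hAt
  -- the two kernels coincide
  obtain ⟨τ, -, hτr⟩ := exists_transport (A := A) κ₀ hH
  have hkers : (resOfLe A hH).ker =
      (ResKernel.resSubgroup (kerK (ProcyclicDescent.rescale (κ₀.comp (subgroupIncl Gn)) (c + n) hdiv)) A).ker := by
    ext z
    rw [AddMonoidHom.mem_ker, AddMonoidHom.mem_ker, ← ProcyclicDescent.resOfLe_comp_resSubgroup (A := A) hker.le,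
      AddMonoidHom.comp_apply]
    constructor
    · intro h
      rw [← hτr, h, map_zero, map_zero]
    · intro h
      have h' := congrArg (resOfLe A hker.ge) h
      rw [ProcyclicDescent.resOfLe_resOfLe_of_eq (A := A) hker, map_zero, ← hτr] at h'
      exact τ.injective (by rw [h', map_zero])
  have e : (ProcyclicDescent.fixedSubgroup (A := A)
      (kerK (ProcyclicDescent.rescale (κ₀.comp (subgroupIncl Gn)) (c + n) hdiv))) ≃
      {a : A // ∀ g : G, κ₀ g = 1 → g • a = a} := by
    refine Equiv.subtypeEquivRight fun a ↦ ?_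
    rw [ProcyclicDescent.mem_fixedSubgroup_iff]
    constructor
    · intro h g hg
      have hgn : g ∈ Gn := hH hg
      have hmem : (⟨g, hgn⟩ : Gn) ∈ kerK (ProcyclicDescent.rescale (κ₀.comp (subgroupIncl Gn)) (c + n) hdiv) := by
        rw [hker]; exact hg
      exact h ⟨⟨g, hgn⟩, hmem⟩
    · intro h x
      have hx : ((x : Gn) : G) ∈ kerK κ₀ := by
        have h2 : (x : Gn) ∈ kerK (κ₀.comp (subgroupIncl Gn)) := hker ▸ x.2
        exact h2
      exact h _ hx
  haveI := Finite.of_equiv _ e.symm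
  rw [hkers, hcount]
  refine ⟨Finite.of_equiv _ (ProcyclicDescent.kerResEquiv hAn
      (ProcyclicDescent.rescale (κ₀.comp (subgroupIncl Gn)) (c + n) hdiv) hsurj hone hAt).toEquiv, ?_⟩
  exact (Nat.card_le_card_of_surjective _ (QuotientAddGroup.mk_surjective)).trans (le_of_eq (Nat.card_congr e))

end Generic

/-! ### §4 Counting along the restriction -/

section Counting

variable {X Y : Type*} [AddCommGroup X] [AddCommGroup Y]

/-- **Counting along `f : X → Y` onto a subgroup `S` of `m`-torsion elements.** If every element of `S` is a value of `f`, `f`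
maps `X[m]` into `S`, and `ker f`, `X[m]` are finite, then `S` is finite, `#X[m] ≤ #ker f · #S` and `#S ≤ #X[m]`
(`#f⁻¹(S) = #S · #ker f`, `X[m] ≤ f⁻¹(S) ≤ (m·)⁻¹(ker f)`). [folklore] -/
theorem finite_and_le_and_le_of_res (f : X →+ Y) (S : AddSubgroup Y) (m : ℕ) (hS : ∀ y ∈ S, m • y = 0)
    (hsurj : ∀ y ∈ S, ∃ x, f x = y) (himg : ∀ x : X, m • x = 0 → f x ∈ S)
    [Finite f.ker] [Finite (nsmulAddMonoidHom (α := X) m).ker] :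
    Finite S ∧ Nat.card (nsmulAddMonoidHom (α := X) m).ker ≤ Nat.card f.ker * Nat.card S ∧
      Nat.card S ≤ Nat.card (nsmulAddMonoidHom (α := X) m).ker := by
  classical
  -- `C = f⁻¹(S) ≤ T' = (m·)⁻¹(ker f)`
  set C : AddSubgroup X := S.comap f with hC
  set T' : AddSubgroup X := (f.ker).comap (nsmulAddMonoidHom (α := X) m) with hT'
  have hCT : C ≤ T' := fun x hx ↦ by
    rw [hT', AddSubgroup.mem_comap, AddMonoidHom.mem_ker, nsmulAddMonoidHom_apply, map_nsmul]
    exact hS _ hx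
  obtain ⟨hT'fin, hT'card⟩ :=
    UniversalToricDescentInvariantTorsionBound.finite_comap_and_natCard_comap_le (nsmulAddMonoidHom (α := X) m) f.ker
  haveI : Finite C := Finite.of_injective _ (AddSubgroup.inclusion_injective hCT)
  -- `f| : C ↠ S` with kernel `ker f`
  let g : C →+ S := (f.comp C.subtype).codRestrict S fun x ↦ x.2
  have hgsurj : Function.Surjective g := fun y ↦ by
    obtain ⟨x, hx⟩ := hsurj y y.2
    exact ⟨⟨x, by rw [hC, AddSubgroup.mem_comap, hx]; exact y.2⟩, Subtype.ext hx⟩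
  haveI hSfin : Finite S := Finite.of_surjective g hgsurj
  have hkerle : f.ker ≤ C := fun x hx ↦ by
    rw [hC, AddSubgroup.mem_comap, (AddMonoidHom.mem_ker).mp hx]
    exact S.zero_mem
  have hgker : g.ker = (f.ker).addSubgroupOf C := by
    ext x
    rw [AddMonoidHom.mem_ker, AddSubgroup.mem_addSubgroupOf, AddMonoidHom.mem_ker]
    exact ⟨fun h ↦ congrArg Subtype.val h, fun h ↦ Subtype.ext h⟩
  have hCcard : Nat.card C = Nat.card S * Nat.card f.ker := by
    rw [AddSubgroup.card_eq_card_quotient_mul_card_addSubgroup g.ker,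
      Nat.card_congr (QuotientAddGroup.quotientKerEquivOfSurjective g hgsurj).toEquiv, hgker,
      Nat.card_congr (AddSubgroup.addSubgroupOfEquivOfLe hkerle).toEquiv]
  refine ⟨hSfin, ?_, ?_⟩
  · -- `X[m] ≤ C`
    have hle : (nsmulAddMonoidHom (α := X) m).ker ≤ C := fun x hx ↦ by
      rw [hC, AddSubgroup.mem_comap]
      exact himg x (by rwa [AddMonoidHom.mem_ker, nsmulAddMonoidHom_apply] at hx)
    calc Nat.card (nsmulAddMonoidHom (α := X) m).ker ≤ Nat.card C :=
          Nat.card_le_card_of_injective _ (AddSubgroup.inclusion_injective hle)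
      _ = Nat.card f.ker * Nat.card S := by rw [hCcard, mul_comm]
  · -- `#S · #ker f = #C ≤ #T' ≤ #ker f · #X[m]`
    have hpos : 0 < Nat.card f.ker := Nat.card_pos
    refine Nat.le_of_mul_le_mul_right ?_ hpos
    calc Nat.card S * Nat.card f.ker = Nat.card C := hCcard.symm
      _ ≤ Nat.card T' := Nat.card_le_card_of_injective _ (AddSubgroup.inclusion_injective hCT)
      _ ≤ Nat.card f.ker * Nat.card (nsmulAddMonoidHom (α := X) m).ker := hT'card
      _ = Nat.card (nsmulAddMonoidHom (α := X) m).ker * Nat.card f.ker := mul_comm _ _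

end Counting

/-! ### §5 The two-sided count at the layer -/

section Final

variable {G : Type u} [Group G] [TopologicalSpace G] [IsTopologicalGroup G] [CompactSpace G] [T2Space G]
  [TotallyDisconnectedSpace G]
variable {A : Type u} [AddCommGroup A] [DistribMulAction G A] [TopologicalSpace A] [DiscreteTopology A]
variable {p : ℕ} [Fact p.Prime] (κ₀ : G →ₜ* Multiplicative ℤ_[p])
variable {c : ℕ} {δ₁ : G} (hδ₁ : (κ₀ δ₁).toAdd = (p : ℤ_[p]) ^ c)
variable {Gn : Subgroup G} {n : ℕ} (hGn : ∀ g : G, g ∈ Gn ↔ (p : ℤ_[p]) ^ (c + n) ∣ (κ₀ g).toAdd)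

include hδ₁ hGn in
/-- **The two-sided count at the layer `n`**: for `S(n,k) = {y ∈ H¹(H, A) | p^k y = 0, conj_{δ₁^{p^n}} y = y}` (`H = ker κ₀`),
`S(n,k)` is finite, `#H¹(G_n, A)[p^k] ≤ #A^H · #S(n,k)` and `#S(n,k) ≤ #H¹(G_n, A)[p^k]`, granted `G_n` closed, `A^H` and
`H¹(G_n, A)[p^k]` finite, and the uniform stabiliser property (A2) of the classes of `H¹(H, A)`. [cite: GreenbergLNM1716, §3 Lemma 3.3]
[cite: SerreGaloisCohomology1997, I §2.6 (b)] [cite: GreenbergVatsal2000, §2 Prop. (2.1) (local terms at `p`)] -/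
theorem twoSided_count_layer (hA : ∀ a : A, IsOpen {g : G | g • a = a})
    (hAt : Literature.NumberTheory.GaloisRepresentations.IsPrimaryTorsion p A) (hGc : IsClosed (Gn : Set G))
    (hfix : ∀ y : subgroupH1 (kerK κ₀) A, ∃ t : ℕ, ∀ g : G, (p : ℤ_[p]) ^ t ∣ (κ₀ g).toAdd → conjH1 (kerK κ₀) A g y = y)
    [Finite {a : A // ∀ g : G, κ₀ g = 1 → g • a = a}] (k : ℕ) [Finite {z : subgroupH1 Gn A // p ^ k • z = 0}] :
    Set.Finite {y : subgroupH1 (kerK κ₀) A | p ^ k • y = 0 ∧ conjH1 (kerK κ₀) A (δ₁ ^ p ^ n) y = y} ∧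
    Nat.card {z : subgroupH1 Gn A // p ^ k • z = 0} ≤
      Nat.card {a : A // ∀ g : G, κ₀ g = 1 → g • a = a} *
        Nat.card {y : subgroupH1 (kerK κ₀) A // p ^ k • y = 0 ∧ conjH1 (kerK κ₀) A (δ₁ ^ p ^ n) y = y} ∧
    Nat.card {y : subgroupH1 (kerK κ₀) A // p ^ k • y = 0 ∧ conjH1 (kerK κ₀) A (δ₁ ^ p ^ n) y = y} ≤
      Nat.card {z : subgroupH1 Gn A // p ^ k • z = 0} := by
  haveI : Gn.Normal := normal_layer κ₀ hGn
  have hH : kerK κ₀ ≤ Gn := kerK_le_layer κ₀ hGn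
  -- the subgroup `S(n,k)` of `p^k`-torsion `G_n`-invariant classes
  let S : AddSubgroup (subgroupH1 (kerK κ₀) A) :=
    { carrier := {y | p ^ k • y = 0 ∧ ∀ g : G, g ∈ Gn → conjH1 (kerK κ₀) A g y = y}
      zero_mem' := ⟨smul_zero _, fun g _ ↦ map_zero _⟩
      add_mem' := fun {a b} ha hb ↦ ⟨by rw [smul_add, ha.1, hb.1, add_zero], fun g hg ↦ by rw [map_add, ha.2 g hg, hb.2 g hg]⟩
      neg_mem' := fun {a} ha ↦ ⟨by rw [smul_neg, ha.1, neg_zero], fun g hg ↦ by rw [map_neg, ha.2 g hg]⟩ }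
  have hmemS : ∀ y, y ∈ S ↔ p ^ k • y = 0 ∧ conjH1 (kerK κ₀) A (δ₁ ^ p ^ n) y = y := fun y ↦ by
    rw [conjH1_pow_eq_self_iff_forall_layer κ₀ hδ₁ hGn y (hfix y)]
    rfl
  have eS : S ≃ {y : subgroupH1 (kerK κ₀) A // p ^ k • y = 0 ∧ conjH1 (kerK κ₀) A (δ₁ ^ p ^ n) y = y} :=
    Equiv.subtypeEquivRight hmemS
  have eX : (nsmulAddMonoidHom (α := subgroupH1 Gn A) (p ^ k)).ker ≃ {z : subgroupH1 Gn A // p ^ k • z = 0} :=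
    Equiv.subtypeEquivRight fun z ↦ by rw [AddMonoidHom.mem_ker, nsmulAddMonoidHom_apply]
  haveI : Finite (nsmulAddMonoidHom (α := subgroupH1 Gn A) (p ^ k)).ker := Finite.of_equiv _ eX.symm
  -- the restriction and its kernel
  obtain ⟨hkerfin, hker⟩ := natCard_ker_resOfLe_le κ₀ hδ₁ hGn hA hAt hGc
  haveI : Finite (resOfLe A hH).ker := hkerfin
  obtain ⟨hSfin, h1, h2⟩ := finite_and_le_and_le_of_res (resOfLe A hH) S (p ^ k) (fun y hy ↦ hy.1)
    (fun y hy ↦ exists_resOfLe_eq_of_forall κ₀ hA hAt hGc hH y hy.2)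
    (fun z hz ↦ ⟨by rw [← map_nsmul, hz, map_zero], fun g hg ↦ by
      rw [← AddMonoidHom.comp_apply, ← resOfLe_comp_conjH1_holds (M := A) hH g, AddMonoidHom.comp_apply,
        conjH1_of_mem_holds Gn A hg, AddMonoidHom.id_apply]⟩)
  refine ⟨?_, ?_, ?_⟩
  · exact (Set.finite_coe_iff.mp (Finite.of_equiv _ eS.symm.symm))
  · rw [← Nat.card_congr eX, ← Nat.card_congr eS]
    exact h1.trans (Nat.mul_le_mul_right _ hker)
  · rw [← Nat.card_congr eX, ← Nat.card_congr eS]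
    exact h2

end Final

end Summit.BirchSwinnertonDyer.BirchSwinnertonDyer.Theorems.UniversalToricDescentTowerDescent

end
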